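import Literature.NumberTheory.LFunctions.ExceptionalCharacterPrimesInProgressions
import HarnessLib

/-!
# Primes in arithmetic progressions to moduli `q < x^{2/3−ε}` in the presence of an exceptional
# character, for almost all residues / on average over moduli (Wright, preprint 2025; CLAIMS)

Topic `Literature/NumberTheory/LFunctions` (namespace `Literature.NumberTheory.LFunctions`; the
paper's quantity `𝓛(χ)` in the sub-namespace `Wright2025`). STATEMENT LAYER for the cell
`parity-realchar` (SIEGEL INSTRUMENT, D-0070 deliverable (3), topic I.2 — a further SOURCE next to
`FriedlanderIwaniec2003_psi` and `IllusoryPrimesInProgressionsLevel.lean`). Source: T. Wright,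
*Primes in Arithmetic Progressions to Large Moduli and Siegel Zeroes*, arXiv:2507.10780 (2025)
[Wright2025SiegelLargeModuli] — a PREPRINT, arXiv-only (zbMATH): every statement is a CLAIM (D-0012),
typed AS PRINTED from the held copy (corpus-tex; VERSION OF RECORD: the arXiv version ingested by
the corpus, unstamped — the July 2025 submission; re-check against later versions before any use,
cf. the v1/v2 episode recorded in `IllusoryPrimesInProgressionsLevel.lean`), §2 Theorems 2.2, 2.3,
2.4 (p. 4–5). Nothing is proved or asserted here.

The setting (§2, p. 4): `(a,q) = 1` throughout; `ψ(x)`, `ψ(x,q,a)` Chebyshev's functions (tree: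
`Chebyshev.psi`, `ParityWave0.chebyshevPsiMod`); "For some large power of `A` (say, `A = 10,000`),
write `𝓛(χ) = max{L(1,χ), log^{−A} x}`" (`Wright2025.scriptL χ x`, with `A = 10 000` literally);
"we will generally assume that any `ε < 1/500` and `α < 1/500`"; `χ = χ_D` a real character mod `D`
(rendered: primitive quadratic, `D ≥ 3`, as in every file of this column); "`log D = (log x)^κ` for
some `κ < 1`" is kept as an EQUATION tying `x` to `D` (literal). The averaging is stated literally
(theory seat 2026-08-26: "state the averaging — almost all `a` / almost all `q` — literally; it is
weaker than a pointwise level"): Theorem 2.2 = an upper bound for EVERY coprime `a` plus a lower bound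
outside an exceptional set of residues of size `O(φ(q) h^{−1} 𝓛(χ) log⁵x)`; Theorem 2.4 = the sum over
`q ∼ Q`, `(a,q) = 1`, for ONE fixed integer `a`.

WHAT THIS IS NOT: no endorsement of the preprint; no pointwise level `2/3`; nothing here bears on
parity. No instances, no notation.
-/

noncomputable section

open scoped Classical

namespace Literature.NumberTheory.LFunctions

open Literature.NumberTheory.Sieve

namespace Wright2025

/-- "`𝓛(χ) = max{L(1,χ), log^{−A} x}`" with the paper's "say, `A = 10,000`" (p. 4), on the norm of
`L(1,χ)` (a definition, typed from the preprint's §2). [cite: Wright2025SiegelLargeModuli, §2 (p. 4), definition of 𝓛(χ)] -/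
def scriptL {D : ℕ} [NeZero D] (χ : DirichletCharacter ℂ D) (x : ℝ) : ℝ :=
  max ‖χ.LFunction 1‖ (Real.log x ^ (-(10000 : ℝ)))

/-- `𝓛(χ) ≥ L(1,χ)` (norm form). [cite: Wright2025SiegelLargeModuli, §2 (p. 4), definition of 𝓛(χ)] -/
theorem norm_LFunction_one_le_scriptL {D : ℕ} [NeZero D] (χ : DirichletCharacter ℂ D) (x : ℝ) :
    ‖χ.LFunction 1‖ ≤ scriptL χ x :=
  le_max_left _ _

end Wright2025

open Wright2025

/-- **Wright 2025 (preprint), Theorem 2.2 — CLAIM, as printed.** "Let `x` and `D` be such that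
`log D = (log x)^κ` for some `κ < 1`, let `√x < q < D^{−1} x^{2/3−ε}` for any `ε > 0`, and let
`(a,q) = 1`. Then `ψ(x,q,a) ≤ ((1 − χ_D(aD/(D,q)) + O(𝓛(χ) log⁵ x))/φ(q)) ψ(x)`. Moreover, for a
given `q` as above, for any function `h = h(x) < 1`, the equation
`ψ(x,q,a) ≥ ((1 − h − χ_D(aD/(D,q)))/φ(q)) ψ(x)` holds for all but `O((φ(q)/h)(𝓛(χ) log⁵ x))` values
of `a` with `(a,q) = 1`. This result is obviously non-trivial if `L(1,χ) = o(log^{−5} x)`." Rendered: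
for all `κ ∈ (0,1)` and `ε > 0` there is `K > 0` such that for every `D ≥ 3`, primitive quadratic `χ`
mod `D`, real `x ≥ 2` with `log D = (log x)^κ`, and modulus `q` with `√x < q < x^{2/3−ε}/D`:
(a) for every `a` coprime to `q`, `ψ(x,q,a) ≤ (1 − χ(a·D/(D,q)) + K 𝓛(χ) log⁵x) ψ(x)/φ(q)`;
(b) for every `0 < h < 1`, the coprime residues `a` mod `q` with
`ψ(x,q,a) < (1 − h − χ(a·D/(D,q))) ψ(x)/φ(q)` number at most `K (φ(q)/h) 𝓛(χ) log⁵x`.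
UNREFEREED; not proved here. [claim: Wright2025SiegelLargeModuli, status: under-review] -/
def wright2025_theorem22 : Prop :=
  ∀ κ : ℝ, 0 < κ → κ < 1 → ∀ ε : ℝ, 0 < ε → ∃ K : ℝ, 0 < K ∧
    ∀ (D : ℕ) [NeZero D], 3 ≤ D → ∀ χ : DirichletCharacter ℂ D, χ.IsPrimitive → χ.IsQuadratic →
      ∀ x : ℝ, 2 ≤ x → Real.log D = Real.log x ^ κ →
        ∀ q : ℕ, Real.sqrt x < q → (q : ℝ) < x ^ ((2 : ℝ) / 3 - ε) / D →
          (∀ a : ℕ, a.Coprime q →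
              ParityWave0.chebyshevPsiMod q (a : ZMod q) x ≤
                (1 - (χ ((a * (D / Nat.gcd D q) : ℕ) : ZMod D)).re +
                    K * scriptL χ x * Real.log x ^ 5) *
                  (Chebyshev.psi x / (q.totient : ℝ))) ∧
          (∀ h : ℝ, 0 < h → h < 1 →
              (((Finset.range q).filter fun a : ℕ =>
                    a.Coprime q ∧
                      ParityWave0.chebyshevPsiMod q (a : ZMod q) x <
                        (1 - h - (χ ((a * (D / Nat.gcd D q) : ℕ) : ZMod D)).re) *
                          (Chebyshev.psi x / (q.totient : ℝ))).card : ℝ) ≤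
                K * ((q.totient : ℝ) / h) * scriptL χ x * Real.log x ^ 5)

/-- **Wright 2025 (preprint), Theorem 2.3 — CLAIM, as printed.** "Let `x`, `D`, `q`, and `a` be as
in Theorem 2.2, with the additional restriction that `D ∣ q` and `χ(a) = 1`. Then
`ψ(x,q,a) ≤ x L(1,χ) log x / q + O(D q^{1/2+α})`. This is non-trivial if `L(1,χ) ≤ c/log x` for
some `C`." (`α < 1/500` per the paper's standing convention.) Rendered: for all `κ ∈ (0,1)`, `ε > 0`,
`0 < α < 1/500` there is `K > 0` such that for `D`, `χ`, `x`, `q` as in Theorem 2.2 with `D ∣ q` and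
every `a` coprime to `q` with `χ(a) = 1`: `ψ(x,q,a) ≤ x ‖L(1,χ)‖ log x / q + K D q^{1/2+α}`.
UNREFEREED; not proved here. [claim: Wright2025SiegelLargeModuli, status: under-review] -/
def wright2025_theorem23 : Prop :=
  ∀ κ : ℝ, 0 < κ → κ < 1 → ∀ ε : ℝ, 0 < ε → ∀ α : ℝ, 0 < α → α < 1 / 500 → ∃ K : ℝ, 0 < K ∧
    ∀ (D : ℕ) [NeZero D], 3 ≤ D → ∀ χ : DirichletCharacter ℂ D, χ.IsPrimitive → χ.IsQuadratic →
      ∀ x : ℝ, 2 ≤ x → Real.log D = Real.log x ^ κ →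
        ∀ q : ℕ, Real.sqrt x < q → (q : ℝ) < x ^ ((2 : ℝ) / 3 - ε) / D → D ∣ q →
          ∀ a : ℕ, a.Coprime q → χ (a : ZMod D) = 1 →
            ParityWave0.chebyshevPsiMod q (a : ZMod q) x ≤
              x * ‖χ.LFunction 1‖ * Real.log x / q + K * D * (q : ℝ) ^ ((1 : ℝ) / 2 + α)

/-- **Wright 2025 (preprint), Theorem 2.4 — CLAIM, as printed.** "Let `a ∈ ℤ`, let `x` and `D` be
such that `log D = (log x)^κ` for some `κ < 1`, and let `Q` be such that `Q < x^{2/3−ε}`. Then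
`∑_{q ∼ Q, (a,q)=1} |ψ(x,q,a) − ψ(x)/φ(q)| ≪ x 𝓛(χ) log⁵ x`." (The fixed-residue form (2.4) of a level
of distribution, "slightly more tractable than" the Elliott–Halberstam form; abstract: "for any fixed
`a`, the [illusory asymptotic] holds for almost all `q < x^{2/3−ε}` with `(a,q) = 1`".) Rendered: for
every integer `a`, all `κ ∈ (0,1)` and `ε > 0` there is `K > 0` such that for every `D ≥ 3`, primitive
quadratic `χ` mod `D`, real `x ≥ 2` with `log D = (log x)^κ` and real `1 ≤ Q < x^{2/3−ε}`:
`∑_{⌈Q⌉ ≤ q ≤ ⌊2Q⌋, gcd(a,q) = 1} |ψ(x,q,a) − ψ(x)/φ(q)| ≤ K x 𝓛(χ) log⁵ x`. UNREFEREED; not proved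
here. [claim: Wright2025SiegelLargeModuli, status: under-review] -/
def wright2025_theorem24 : Prop :=
  ∀ a : ℤ, ∀ κ : ℝ, 0 < κ → κ < 1 → ∀ ε : ℝ, 0 < ε → ∃ K : ℝ, 0 < K ∧
    ∀ (D : ℕ) [NeZero D], 3 ≤ D → ∀ χ : DirichletCharacter ℂ D, χ.IsPrimitive → χ.IsQuadratic →
      ∀ x : ℝ, 2 ≤ x → Real.log D = Real.log x ^ κ →
        ∀ Q : ℝ, 1 ≤ Q → Q < x ^ ((2 : ℝ) / 3 - ε) →
          ∑ q ∈ (Finset.Icc ⌈Q⌉₊ ⌊2 * Q⌋₊).filter (fun q : ℕ => Int.gcd a q = 1),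
              |ParityWave0.chebyshevPsiMod q (a : ZMod q) x - Chebyshev.psi x / (q.totient : ℝ)| ≤
            K * x * scriptL χ x * Real.log x ^ 5

end Literature.NumberTheory.LFunctions

end
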